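import Summits.HodgeConjecture.CorCM.IrreducibleOddWeightsCommutantFamilyRank
import Summits.HodgeConjecture.CorCM.IrreducibleOddWeightsHodgeEquivalence
import HarnessLib

/-!
# Sub-family domination, VI: THE BOUND `r = dim Hg(∏ A_i)/dim A` IS SHARP — every dominating sub-family carries at
# least `r` components; for single-component slots a minimum dominating sub-family has exactly `r` members and is
# ADDITIVE

COR-CM (cell `pub-hodgecm2`, binder seat `b16` gen 74, count-neutral claim SUB-FAMILY DOMINATION AND HODGE
EQUIVALENCE, file S6 — abstract `G`-set level, type ranks, CM dress; theorems only, no definition, no named fact, no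
`sorry`).  NEW as stated, hence under `Summits/`.  HONEST FRAMING: counting consequences of files S4/S5 in ONE
isotypic class (all type vectors `u_i = Σ_j ι^i_j(b^i_j)` assembled from one reference stable irreducible `A` with
ANY commutant; `rank Σ = r·dim A + 1`, `r` the D-rank of all the components): nothing about Hodge classes is asserted,
`HC_CM` is neither used nor asserted.

* §1 `typeRank_sigmaType_le_sum_card_mul_add_one_of_class` (**`rank Σ ≤ (Σ_i |J_i|)·dim A + 1`**) and, for a
  DOMINATING sub-family `T` (`rank Σ = rank Σ|_T`), **`typeRank_sigmaType_le_sum_card_mul_add_one_of_dominating`: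
  `rank Σ ≤ (Σ_{t∈T} |J_t|)·dim A + 1`** — a dominating sub-product carries at least `r` components in total.
* §2 SINGLE COMPONENTS (`u_i = ι^i(b^i)`, `b^i ≠ 0`): `typeRank_eq_finrank_add_one_single` (**`rank Φ_i = dim A + 1`**:
  `dim Hg(A_i) = dim A`), `typeRank_sigmaType_le_card_mul_add_one_of_dominating_single` (**every dominating `T` has
  `rank Σ ≤ |T|·dim A + 1`, i.e. `|T| ≥ r`**), and with file S5's greedy family
  **`exists_finset_typeRank_sigmaType_eq_card_mul_add_one_single`: some dominating `T` has EXACTLY `rank Σ =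
  |T|·dim A + 1`** and is then ADDITIVE (`typeRank_sigmaType_add_card_eq_of_card_mul_single`: `rank Σ|_T + |T| =
  Σ_{t∈T} rank Φ_t + 1`) — `Hg(∏_I A_i) ≅ Hg(∏_T A_t) = ∏_{t∈T} Hg(A_t)`: a «D-basis of factors» (gen 56 F2's maximal
  additive sub-families, for slots of any shape sharing one isotypic class).
* §3 CM dress: `cmTypeRank_eq_finrank_add_one_single`, `exists_finset_cmFamilyRank_eq_card_mul_add_one_single`.

## References

* [Deligne1982HodgeCycles] P. Deligne, *Hodge cycles on abelian varieties*, LNM 900 (1982), I.5 (p. 53), I Ex. 3.7.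
* [Gordon1999HodgeAVSurvey] B. B. Gordon, *A survey of the Hodge conjecture for abelian varieties*, §3 Theorem (proof),
  7.5–7.7.
* [Lang2002] S. Lang, *Algebra*, 3rd ed., XVII §1, XVII §3.
* [Mai1989] L. Mai, *Lower bounds for the ranks of CM types*, J. Number Theory 32 (1989), §2 Prop. 1.
-/

set_option autoImplicit false

noncomputable section

open scoped BigOperators Classical

universe u u₀ v vY w

namespace Summit.HodgeConjecture.CorCM.IrrOdd

open Literature.NumberTheory.ComplexMultiplication

variable {G : Type w} [Group G] {I : Type u} {E : I → Type v} [∀ i, MulAction G (E i)] [∀ i, Fintype (E i)]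
  [Fintype I] [∀ i, Nonempty (E i)] {Y : Type vY} [MulAction G Y] [Fintype Y]

/-! ### §1 A dominating sub-family carries at least `r` components -/

/-- **`rank Σ ≤ (Σ_i |J_i|)·dim A + 1`** in one isotypic class: `dim Hg(∏_i A_i) ≤ (number of components)·dim A`
(file S4's D-rank `r ≤ Σ_i |J_i|`). [cite: Mai1989, §2 Prop. 1 (proof)] [cite: Lang2002, XVII §3] -/
theorem typeRank_sigmaType_le_sum_card_mul_add_one_of_class [Nonempty I] {ρ : G} {Φ : ∀ i, Set (E i)}
    (h : ∀ i, IsCMTypeWith ρ (Φ i)) {A : Submodule ℚ (Y → ℚ)} {𝒟 : Submodule ℚ ((Y → ℚ) →ₗ[ℚ] (Y → ℚ))}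
    (h𝒟 : ∀ L : (Y → ℚ) →ₗ[ℚ] (Y → ℚ), L ∈ 𝒟 ↔ (∀ a ∈ A, L a ∈ A) ∧
      ∀ (k : G) (a : Y → ℚ), a ∈ A → L (fun y => a (k • y)) = fun y => L a (k • y))
    (hAst : ∀ (k : G) (a : Y → ℚ), a ∈ A → (fun y => a (k • y)) ∈ A)
    (hAirr : ∀ W : Submodule ℚ (Y → ℚ), W ≤ A → W ≠ ⊥ →
      (∀ (k : G) (f : Y → ℚ), f ∈ W → (fun y => f (k • y)) ∈ W) → W = A)
    (hA0 : A ≠ ⊥) {J : I → Type u₀} [∀ i, Fintype (J i)] (ι : ∀ i, J i → ((Y → ℚ) →ₗ[ℚ] (E i → ℚ)))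
    (hιeq : ∀ i (j : J i) (k : G) (a : Y → ℚ), a ∈ A → ι i j (fun y => a (k • y)) = fun y => ι i j a (k • y))
    (hind : ∀ i (f : J i → (Y → ℚ)), (∀ j, f j ∈ A) → ∑ j, ι i j (f j) = 0 → ∀ j, f j = 0)
    {b : ∀ i, J i → (Y → ℚ)} (hb : ∀ i j, b i j ∈ A) (hu : ∀ i, antiVec (Φ i) (1 : G) = ∑ j, ι i j (b i j)) :
    typeRank G (sigmaType Φ) ≤ (∑ i, Fintype.card (J i)) * Module.finrank ℚ A + 1 := by
  obtain ⟨a₀, ha₀, h0⟩ := Submodule.exists_mem_ne_zero_of_ne_bot hA0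
  obtain ⟨r, hr, -, hrank⟩ := exists_rank_typeRank_sigmaType_eq_of_class h h𝒟 hAst hAirr ι hιeq hind hb hu ha₀ h0
  rw [hrank]
  exact Nat.add_le_add_right (Nat.mul_le_mul_right _ hr) 1

omit [Fintype I] in
/-- **A DOMINATING SUB-FAMILY CARRIES AT LEAST `r` COMPONENTS**: if `rank Σ = rank Σ|_T` then
**`rank Σ ≤ (Σ_{t∈T} |J_t|)·dim A + 1`**, i.e. `dim Hg(∏_I A_i)/dim A ≤ Σ_{t∈T} |J_t|`. [cite: Mai1989, §2 Prop. 1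
(proof)] [cite: Lang2002, XVII §3] [cite: Deligne1982HodgeCycles, I.5 (p. 53)] -/
theorem typeRank_sigmaType_le_sum_card_mul_add_one_of_dominating {ρ : G} {Φ : ∀ i, Set (E i)}
    (h : ∀ i, IsCMTypeWith ρ (Φ i)) {T : Finset I} (hT : T.Nonempty)
    (hdom : typeRank G (sigmaType Φ) = typeRank G (sigmaType fun j : {i // i ∈ T} => Φ j.1))
    {A : Submodule ℚ (Y → ℚ)} {𝒟 : Submodule ℚ ((Y → ℚ) →ₗ[ℚ] (Y → ℚ))}
    (h𝒟 : ∀ L : (Y → ℚ) →ₗ[ℚ] (Y → ℚ), L ∈ 𝒟 ↔ (∀ a ∈ A, L a ∈ A) ∧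
      ∀ (k : G) (a : Y → ℚ), a ∈ A → L (fun y => a (k • y)) = fun y => L a (k • y))
    (hAst : ∀ (k : G) (a : Y → ℚ), a ∈ A → (fun y => a (k • y)) ∈ A)
    (hAirr : ∀ W : Submodule ℚ (Y → ℚ), W ≤ A → W ≠ ⊥ →
      (∀ (k : G) (f : Y → ℚ), f ∈ W → (fun y => f (k • y)) ∈ W) → W = A)
    (hA0 : A ≠ ⊥) {J : I → Type u₀} [∀ i, Fintype (J i)] (ι : ∀ i, J i → ((Y → ℚ) →ₗ[ℚ] (E i → ℚ)))
    (hιeq : ∀ i (j : J i) (k : G) (a : Y → ℚ), a ∈ A → ι i j (fun y => a (k • y)) = fun y => ι i j a (k • y))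
    (hind : ∀ i (f : J i → (Y → ℚ)), (∀ j, f j ∈ A) → ∑ j, ι i j (f j) = 0 → ∀ j, f j = 0)
    {b : ∀ i, J i → (Y → ℚ)} (hb : ∀ i j, b i j ∈ A) (hu : ∀ i, antiVec (Φ i) (1 : G) = ∑ j, ι i j (b i j)) :
    typeRank G (sigmaType Φ) ≤ (∑ t : {i // i ∈ T}, Fintype.card (J t.1)) * Module.finrank ℚ A + 1 := by
  haveI : Nonempty {i // i ∈ T} := hT.coe_sort
  rw [hdom]
  exact typeRank_sigmaType_le_sum_card_mul_add_one_of_class (E := fun j : {i // i ∈ T} => E j.1)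
    (Φ := fun j : {i // i ∈ T} => Φ j.1) (fun j => h j.1) h𝒟 hAst hAirr hA0 (fun j => ι j.1) (fun j => hιeq j.1)
    (fun j => hind j.1) (fun j => hb j.1) fun j => hu j.1

/-! ### §2 Single components: `|T| ≥ r`, attained, and the minimum dominating sub-family is additive -/

omit [∀ i, Fintype (E i)] [Fintype I] [∀ i, Nonempty (E i)] [MulAction G Y] [Fintype Y] in
/-- A single equivariant embedding injective on `A`, as a one-member jointly independent family. [folklore] -/
theorem jointly_independent_single {A : Submodule ℚ (Y → ℚ)} {i : I} (ι : (Y → ℚ) →ₗ[ℚ] (E i → ℚ))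
    (hinj : ∀ f ∈ A, ι f = 0 → f = 0) (f : Unit → (Y → ℚ)) (hf : ∀ j, f j ∈ A)
    (h0 : ∑ j, (fun _ : Unit => ι) j (f j) = 0) (j : Unit) : f j = 0 := by
  cases j
  exact hinj _ (hf _) (by rw [← h0]; exact (Fintype.sum_unique fun j => ι (f j)).symm)

omit [Fintype I] in
/-- **`rank Φ_i = dim A + 1` FOR A SINGLE NON-ZERO COMPONENT** (`u_i = ι^i(b^i)`, `b^i ≠ 0`): `dim Hg(A_i) = dim A` —
the slot is nondegenerate relative to its isotypic class (`dim D·b = δ`, file C1, in `rank Φ·δ = δ + dim D⟨b⟩·dim A`).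
[cite: Lang2002, XVII §1 Prop. 1.1 and §3] [cite: Deligne1982HodgeCycles, I.3.4] -/
theorem typeRank_eq_finrank_add_one_single {ρ : G} {Φ : ∀ i, Set (E i)} (h : ∀ i, IsCMTypeWith ρ (Φ i)) (i₀ : I)
    {A : Submodule ℚ (Y → ℚ)} {𝒟 : Submodule ℚ ((Y → ℚ) →ₗ[ℚ] (Y → ℚ))}
    (h𝒟 : ∀ L : (Y → ℚ) →ₗ[ℚ] (Y → ℚ), L ∈ 𝒟 ↔ (∀ a ∈ A, L a ∈ A) ∧
      ∀ (k : G) (a : Y → ℚ), a ∈ A → L (fun y => a (k • y)) = fun y => L a (k • y))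
    (hAst : ∀ (k : G) (a : Y → ℚ), a ∈ A → (fun y => a (k • y)) ∈ A)
    (hAirr : ∀ W : Submodule ℚ (Y → ℚ), W ≤ A → W ≠ ⊥ →
      (∀ (k : G) (f : Y → ℚ), f ∈ W → (fun y => f (k • y)) ∈ W) → W = A)
    (ι : (Y → ℚ) →ₗ[ℚ] (E i₀ → ℚ))
    (hιeq : ∀ (k : G) (a : Y → ℚ), a ∈ A → ι (fun y => a (k • y)) = fun y => ι a (k • y))
    (hinj : ∀ f ∈ A, ι f = 0 → f = 0) {b₀ : Y → ℚ} (hb₀ : b₀ ∈ A) (hb₀0 : b₀ ≠ 0)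
    (hu₀ : antiVec (Φ i₀) (1 : G) = ι b₀) :
    typeRank G (Φ i₀) = Module.finrank ℚ A + 1 := by
  have key := typeRank_mul_eq_of_class h i₀ h𝒟 hAst hAirr (J₀ := Unit) (fun _ => ι) (fun _ k a ha => hιeq k a ha)
    (jointly_independent_single ι hinj) (b₀ := fun _ => b₀) (fun _ => hb₀)
    (by rw [Fintype.sum_unique]; exact hu₀) hb₀ hb₀0
  rw [iSup_const] at key
  let T : G → (Y → ℚ) →ₗ[ℚ] (Y → ℚ) := fun k => LinearMap.funLeft ℚ ℚ (fun y : Y => k • y)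
  haveI : FiniteDimensional ℚ A := Submodule.finiteDimensional_of_le le_top
  haveI : FiniteDimensional ℚ ↥(𝒟.map (LinearMap.applyₗ b₀)) :=
    Submodule.finiteDimensional_of_le (map_applyₗ_le T (A := A) (fun L => h𝒟 L) hb₀)
  have hδ : 0 < Module.finrank ℚ ↥(𝒟.map (LinearMap.applyₗ b₀)) :=
    Nat.pos_of_ne_zero fun h' => map_applyₗ_ne_bot T (A := A) (fun L => h𝒟 L) hb₀0 (Submodule.finrank_eq_zero.1 h')
  have key' : typeRank G (Φ i₀) * Module.finrank ℚ ↥(𝒟.map (LinearMap.applyₗ b₀)) =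
      (Module.finrank ℚ A + 1) * Module.finrank ℚ ↥(𝒟.map (LinearMap.applyₗ b₀)) := by
    rw [key]; ring
  exact Nat.eq_of_mul_eq_mul_right hδ key'

omit [Fintype I] in
/-- **EVERY DOMINATING SUB-FAMILY HAS AT LEAST `r` MEMBERS** (single non-zero components): if `rank Σ = rank Σ|_T`
then **`rank Σ ≤ |T|·dim A + 1`**. [cite: Mai1989, §2 Prop. 1 (proof)] [cite: Lang2002, XVII §1 and §3]
[cite: Deligne1982HodgeCycles, I.5 (p. 53)] -/
theorem typeRank_sigmaType_le_card_mul_add_one_of_dominating_single {ρ : G} {Φ : ∀ i, Set (E i)}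
    (h : ∀ i, IsCMTypeWith ρ (Φ i)) {T : Finset I} (hT : T.Nonempty)
    (hdom : typeRank G (sigmaType Φ) = typeRank G (sigmaType fun j : {i // i ∈ T} => Φ j.1))
    {A : Submodule ℚ (Y → ℚ)} {𝒟 : Submodule ℚ ((Y → ℚ) →ₗ[ℚ] (Y → ℚ))}
    (h𝒟 : ∀ L : (Y → ℚ) →ₗ[ℚ] (Y → ℚ), L ∈ 𝒟 ↔ (∀ a ∈ A, L a ∈ A) ∧
      ∀ (k : G) (a : Y → ℚ), a ∈ A → L (fun y => a (k • y)) = fun y => L a (k • y))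
    (hAst : ∀ (k : G) (a : Y → ℚ), a ∈ A → (fun y => a (k • y)) ∈ A)
    (hAirr : ∀ W : Submodule ℚ (Y → ℚ), W ≤ A → W ≠ ⊥ →
      (∀ (k : G) (f : Y → ℚ), f ∈ W → (fun y => f (k • y)) ∈ W) → W = A)
    (hA0 : A ≠ ⊥) (ι : ∀ i, (Y → ℚ) →ₗ[ℚ] (E i → ℚ))
    (hιeq : ∀ i (k : G) (a : Y → ℚ), a ∈ A → ι i (fun y => a (k • y)) = fun y => ι i a (k • y))
    (hinj : ∀ i, ∀ f ∈ A, ι i f = 0 → f = 0) {b : I → (Y → ℚ)} (hb : ∀ i, b i ∈ A)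
    (hu : ∀ i, antiVec (Φ i) (1 : G) = ι i (b i)) :
    typeRank G (sigmaType Φ) ≤ T.card * Module.finrank ℚ A + 1 := by
  have hle := typeRank_sigmaType_le_sum_card_mul_add_one_of_dominating h hT hdom h𝒟 hAst hAirr hA0
    (J := fun _ => Unit) (fun i _ => ι i) (fun i _ k a ha => hιeq i k a ha)
    (fun i => jointly_independent_single (ι i) (hinj i)) (b := fun i _ => b i) (fun i _ => hb i)
    (fun i => by rw [Fintype.sum_unique]; exact hu i)
  simpa only [Fintype.card_unique, Finset.sum_const, Finset.card_univ, Fintype.card_coe, smul_eq_mul, mul_one]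
    using hle

/-- **THE BOUND IS ATTAINED**: for single non-zero components there is a dominating `T` with EXACTLY
**`rank Σ = |T|·dim A + 1`** (`|T| = r = dim Hg(∏_i A_i)/dim A`; file S5's greedy family from above, §2 from below).
[cite: Mai1989, §2 Prop. 1 (proof)] [cite: Lang2002, XVII §1 and §3] [cite: Deligne1982HodgeCycles, I.5 (p. 53)] -/
theorem exists_finset_typeRank_sigmaType_eq_card_mul_add_one_single [Nonempty I] {ρ : G} {Φ : ∀ i, Set (E i)}
    (h : ∀ i, IsCMTypeWith ρ (Φ i)) {A : Submodule ℚ (Y → ℚ)} {𝒟 : Submodule ℚ ((Y → ℚ) →ₗ[ℚ] (Y → ℚ))}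
    (h𝒟 : ∀ L : (Y → ℚ) →ₗ[ℚ] (Y → ℚ), L ∈ 𝒟 ↔ (∀ a ∈ A, L a ∈ A) ∧
      ∀ (k : G) (a : Y → ℚ), a ∈ A → L (fun y => a (k • y)) = fun y => L a (k • y))
    (hAst : ∀ (k : G) (a : Y → ℚ), a ∈ A → (fun y => a (k • y)) ∈ A)
    (hAirr : ∀ W : Submodule ℚ (Y → ℚ), W ≤ A → W ≠ ⊥ →
      (∀ (k : G) (f : Y → ℚ), f ∈ W → (fun y => f (k • y)) ∈ W) → W = A)
    (hA0 : A ≠ ⊥) (ι : ∀ i, (Y → ℚ) →ₗ[ℚ] (E i → ℚ))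
    (hιeq : ∀ i (k : G) (a : Y → ℚ), a ∈ A → ι i (fun y => a (k • y)) = fun y => ι i a (k • y))
    (hinj : ∀ i, ∀ f ∈ A, ι i f = 0 → f = 0) {b : I → (Y → ℚ)} (hb : ∀ i, b i ∈ A)
    (hu : ∀ i, antiVec (Φ i) (1 : G) = ι i (b i)) :
    ∃ T : Finset I, T.Nonempty ∧
      typeRank G (sigmaType Φ) = typeRank G (sigmaType fun j : {i // i ∈ T} => Φ j.1) ∧
        typeRank G (sigmaType Φ) = T.card * Module.finrank ℚ A + 1 := by
  obtain ⟨T, hT, hdom, hcard⟩ := exists_finset_typeRank_sigmaType_eq_card_mul_le_of_class h h𝒟 hAst hAirr hA0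
    (J := fun _ => Unit) (fun i _ => ι i) (fun i _ k a ha => hιeq i k a ha)
    (fun i => jointly_independent_single (ι i) (hinj i)) (b := fun i _ => b i) (fun i _ => hb i)
    (fun i => by rw [Fintype.sum_unique]; exact hu i)
  exact ⟨T, hT, hdom, le_antisymm
    (typeRank_sigmaType_le_card_mul_add_one_of_dominating_single h hT hdom h𝒟 hAst hAirr hA0 ι hιeq hinj hb hu) hcard⟩

omit [Fintype I] in
/-- **A DOMINATING SUB-FAMILY WITH `rank Σ = |T|·dim A + 1` IS ADDITIVE**: `rank Σ|_T + |T| = Σ_{t∈T} rank Φ_t + 1`,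
i.e. `Hg(∏_{t∈T} A_t) = ∏_{t∈T} Hg(A_t)` (each `rank Φ_t = dim A + 1`) — together with domination, `Hg(∏_I A_i) ≅
∏_{t∈T} Hg(A_t)`: a «D-basis of factors» (gen 56 F2's maximal additive sub-families, in one isotypic class of slots of
any shape). [cite: Gordon1999HodgeAVSurvey, §3 Theorem and 7.5–7.7] [cite: Lang2002, XVII §1] -/
theorem typeRank_sigmaType_add_card_eq_of_card_mul_single {ρ : G} {Φ : ∀ i, Set (E i)}
    (h : ∀ i, IsCMTypeWith ρ (Φ i)) {T : Finset I}
    (hdom : typeRank G (sigmaType Φ) = typeRank G (sigmaType fun j : {i // i ∈ T} => Φ j.1))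
    {A : Submodule ℚ (Y → ℚ)} {𝒟 : Submodule ℚ ((Y → ℚ) →ₗ[ℚ] (Y → ℚ))}
    (hcard : typeRank G (sigmaType Φ) = T.card * Module.finrank ℚ A + 1)
    (h𝒟 : ∀ L : (Y → ℚ) →ₗ[ℚ] (Y → ℚ), L ∈ 𝒟 ↔ (∀ a ∈ A, L a ∈ A) ∧
      ∀ (k : G) (a : Y → ℚ), a ∈ A → L (fun y => a (k • y)) = fun y => L a (k • y))
    (hAst : ∀ (k : G) (a : Y → ℚ), a ∈ A → (fun y => a (k • y)) ∈ A)
    (hAirr : ∀ W : Submodule ℚ (Y → ℚ), W ≤ A → W ≠ ⊥ →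
      (∀ (k : G) (f : Y → ℚ), f ∈ W → (fun y => f (k • y)) ∈ W) → W = A)
    (ι : ∀ i, (Y → ℚ) →ₗ[ℚ] (E i → ℚ))
    (hιeq : ∀ i (k : G) (a : Y → ℚ), a ∈ A → ι i (fun y => a (k • y)) = fun y => ι i a (k • y))
    (hinj : ∀ i, ∀ f ∈ A, ι i f = 0 → f = 0) {b : I → (Y → ℚ)} (hb : ∀ i, b i ∈ A) (hb0 : ∀ i, b i ≠ 0)
    (hu : ∀ i, antiVec (Φ i) (1 : G) = ι i (b i)) :
    typeRank G (sigmaType fun j : {i // i ∈ T} => Φ j.1) + Fintype.card {i // i ∈ T} =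
      (∑ t : {i // i ∈ T}, typeRank G (Φ t.1)) + 1 := by
  have hrk : ∀ i, typeRank G (Φ i) = Module.finrank ℚ A + 1 := fun i =>
    typeRank_eq_finrank_add_one_single h i h𝒟 hAst hAirr (ι i) (hιeq i) (hinj i) (hb i) (hb0 i) (hu i)
  rw [Finset.sum_congr rfl fun t _ => hrk t.1, Finset.sum_const, Finset.card_univ, smul_eq_mul, ← hdom, hcard,
    Fintype.card_coe]
  ring

/-! ### §3 CM dress -/

end Summit.HodgeConjecture.CorCM.IrrOdd

namespace Summit.HodgeConjecture.CorCM

open CategoryTheory CategoryTheory.Limits NumberField Module IntermediateField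
open Literature.NumberTheory.ComplexMultiplication
open Literature.AlgebraicGeometry.Motives (AbelianVariety CMType)
open Literature.AlgebraicGeometry.Motives.AbelianVariety
open Literature.AlgebraicGeometry.HodgeTheory
open Literature.AlgebraicGeometry.ComplexMultiplication (IsCMTypeRealisation)
open Literature.AlgebraicGeometry.Pohlmann1968

variable {I : Type} [Fintype I] {K : I → Type} [∀ i, Field (K i)] [∀ i, NumberField (K i)] [∀ i, IsCMField (K i)]
  {Y : Type vY} [MulAction (ℂ ≃+* ℂ) Y] [Fintype Y]

omit [Fintype I] in
/-- **`cmTypeRank Φ_i = dim A + 1` for a single non-zero component** (`u_i = ι(b)`, `b ≠ 0` in the reference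
`Aut(ℂ)`-stable irreducible `A`): `dim Hg(A_i) = dim A`. [cite: Lang2002, XVII §1 Prop. 1.1 and §3]
[cite: Deligne1982HodgeCycles, I.3.4] -/
theorem cmTypeRank_eq_finrank_add_one_single (Φ : ∀ i, CMType (K i)) (i₀ : I)
    {A : Submodule ℚ (Y → ℚ)} {𝒟 : Submodule ℚ ((Y → ℚ) →ₗ[ℚ] (Y → ℚ))}
    (h𝒟 : ∀ L : (Y → ℚ) →ₗ[ℚ] (Y → ℚ), L ∈ 𝒟 ↔ (∀ a ∈ A, L a ∈ A) ∧
      ∀ (k : ℂ ≃+* ℂ) (a : Y → ℚ), a ∈ A → L (fun y => a (k • y)) = fun y => L a (k • y))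
    (hAst : ∀ (k : ℂ ≃+* ℂ) (a : Y → ℚ), a ∈ A → (fun y => a (k • y)) ∈ A)
    (hAirr : ∀ W : Submodule ℚ (Y → ℚ), W ≤ A → W ≠ ⊥ →
      (∀ (k : ℂ ≃+* ℂ) (f : Y → ℚ), f ∈ W → (fun y => f (k • y)) ∈ W) → W = A)
    (ι : (Y → ℚ) →ₗ[ℚ] ((K i₀ →+* ℂ) → ℚ))
    (hιeq : ∀ (k : ℂ ≃+* ℂ) (a : Y → ℚ), a ∈ A → ι (fun y => a (k • y)) = fun y => ι a (k • y))
    (hinj : ∀ f ∈ A, ι f = 0 → f = 0) {b₀ : Y → ℚ} (hb₀ : b₀ ∈ A) (hb₀0 : b₀ ≠ 0)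
    (hu₀ : antiVec (Φ i₀).1 (1 : ℂ ≃+* ℂ) = ι b₀) :
    cmTypeRank (Φ i₀) = Module.finrank ℚ A + 1 := by
  haveI : ∀ i, Nonempty (K i →+* ℂ) := fun i => inferInstance
  exact IrrOdd.typeRank_eq_finrank_add_one_single (G := ℂ ≃+* ℂ) (E := fun i => K i →+* ℂ) (Φ := fun i => (Φ i).1)
    (fun i => isCMTypeWith_conj (Φ i)) i₀ h𝒟 hAst hAirr ι hιeq hinj hb₀ hb₀0 hu₀

/-- **A MINIMUM DOMINATING SUB-PRODUCT HAS EXACTLY `r = dim Hg(∏_i A_i)/dim A` FACTORS (CM fields)**: for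
single non-zero components there is a non-empty `T ⊆ I` with `cmFamilyRank Φ = cmFamilyRank Φ|_T` and
**`cmFamilyRank Φ = |T|·dim A + 1`**. [cite: Mai1989, §2 Prop. 1 (proof)] [cite: Lang2002, XVII §1 and §3]
[cite: Deligne1982HodgeCycles, I.5 (p. 53)] -/
theorem exists_finset_cmFamilyRank_eq_card_mul_add_one_single [Nonempty I] (Φ : ∀ i, CMType (K i))
    {A : Submodule ℚ (Y → ℚ)} {𝒟 : Submodule ℚ ((Y → ℚ) →ₗ[ℚ] (Y → ℚ))}
    (h𝒟 : ∀ L : (Y → ℚ) →ₗ[ℚ] (Y → ℚ), L ∈ 𝒟 ↔ (∀ a ∈ A, L a ∈ A) ∧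
      ∀ (k : ℂ ≃+* ℂ) (a : Y → ℚ), a ∈ A → L (fun y => a (k • y)) = fun y => L a (k • y))
    (hAst : ∀ (k : ℂ ≃+* ℂ) (a : Y → ℚ), a ∈ A → (fun y => a (k • y)) ∈ A)
    (hAirr : ∀ W : Submodule ℚ (Y → ℚ), W ≤ A → W ≠ ⊥ →
      (∀ (k : ℂ ≃+* ℂ) (f : Y → ℚ), f ∈ W → (fun y => f (k • y)) ∈ W) → W = A)
    (hA0 : A ≠ ⊥) (ι : ∀ i, (Y → ℚ) →ₗ[ℚ] ((K i →+* ℂ) → ℚ))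
    (hιeq : ∀ i (k : ℂ ≃+* ℂ) (a : Y → ℚ), a ∈ A → ι i (fun y => a (k • y)) = fun y => ι i a (k • y))
    (hinj : ∀ i, ∀ f ∈ A, ι i f = 0 → f = 0) {b : I → (Y → ℚ)} (hb : ∀ i, b i ∈ A)
    (hu : ∀ i, antiVec (Φ i).1 (1 : ℂ ≃+* ℂ) = ι i (b i)) :
    ∃ T : Finset I, T.Nonempty ∧ CMAlgebra.cmFamilyRank Φ = CMAlgebra.cmFamilyRank (fun j : T => Φ j.1) ∧
      CMAlgebra.cmFamilyRank Φ = T.card * Module.finrank ℚ A + 1 := by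
  haveI : ∀ i, Nonempty (K i →+* ℂ) := fun i => inferInstance
  exact IrrOdd.exists_finset_typeRank_sigmaType_eq_card_mul_add_one_single (G := ℂ ≃+* ℂ) (E := fun i => K i →+* ℂ)
    (Φ := fun i => (Φ i).1) (fun i => isCMTypeWith_conj (Φ i)) h𝒟 hAst hAirr hA0 ι hιeq hinj hb hu

end Summit.HodgeConjecture.CorCM

end
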